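import Literature.FieldTheory.AlgClosed.PadicAlgClosureEmbedsComplex   -- ★ `#F̄_w ≤ 𝔠`, `CharZero F̄_w`, ★ `exists_ringEquiv_apply_eq` (via import)
import Mathlib.FieldTheory.IsAlgClosed.Classification
import Mathlib.Topology.Algebra.Module.Cardinality
import Mathlib.Analysis.Complex.Cardinality
import HarnessLib

/-!
# `F̄_w ≃ ℂ` over a prescribed complex embedding of the number field `F` (Steinitz ∕ «Lefschetz principle» for `F̄_w`)

Topic `FieldTheory/AlgClosed` (namespace `Literature.FieldTheory.AlgClosed`).  THEOREMS ONLY (no definition, no named fact, no `instance`, no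
notation, no `sorry`).  Cell `hodgecm-mathlib` (D-0151), P6 «MOD programme» (crux hLiu418 = stmt-HodgeConjecture-24832, `--supports`, count-neutral), line
«L4» ∕ X-LEAF `Lines/F0_P6a_EExports.lean` (A-p01 (g28)), socket `stub_ECtoΩ` «transport of the E-readings `RoofE`∕`CoverKerE` from `ℂ`-points to `F̄_w`-points
ALONG A RING ISOMORPHISM `F̄_w ≃ ℂ` over `ι₁`» (LA4-plan (g0) DEAL #20′ (i), 2026-09-02): this file supplies the isomorphism.  Sequel of ★
`PadicAlgClosureEmbedsComplex` (`#F̄_w ≤ 𝔠`, an EMBEDDING `F̄_w →+* ℂ` over `ι₁`) in the pattern of ★ `PadicAlgClEquivComplex` ∕ `PadicAlgClEquivComplexCompatible`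
(`ℚ̄_p ≃ ℂ`): here `F̄_w := AlgebraicClosure (w.adicCompletion F)` for a number field `F` and a finite place `w`.
HC_CM is proved only modulo the 2 remaining named inputs (hLiu418 24832, h413 24833) until rung 0 closes; nothing here is about HC.

THE MATHEMATICS (Steinitz 1910; [Lang2002] VIII §1, V §2; [Robert2000PadicAnalysis] III §3.5).  `F_w` is a complete non-trivially normed field (a
uniformiser has norm `< 1`), so `𝔠 ≤ #F_w` (Mathlib `continuum_le_cardinal_of_nontriviallyNormedField`), whence `𝔠 ≤ #F̄_w ≤ 𝔠`; two uncountable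
algebraically closed fields of characteristic `0` and the same cardinality are isomorphic (Mathlib `IsAlgClosed.ringEquiv_of_equiv_of_charZero`); and any
isomorphism is corrected by an automorphism of `ℂ` carrying the induced embedding of the countable field `F` to `ι₁` (★ `exists_ringEquiv_apply_eq`).
The isomorphism is neither continuous nor canonical.

* §1 `continuum_le_cardinalMk_adicCompletion` (`𝔠 ≤ #F_w`), `cardinalMk_algebraicClosure_adicCompletion_eq_continuum` (`#F̄_w = 𝔠`);
* §2 `nonempty_ringEquiv_algebraicClosure_adicCompletion_complex` (`Nonempty (F̄_w ≃+* ℂ)`);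
* §3 **`exists_ringEquiv_algebraicClosure_adicCompletion_complex_comp_eq`** (THE HEAD: `∃ σ : F̄_w ≃+* ℂ, σ ∘ (F → F̄_w) = ι₁`), and its `F`-algebra
  form `nonempty_algEquiv_algebraicClosure_adicCompletion_complex` (`ℂ` an `F`-algebra through `ι₁`).

## References
* [Lang2002] S. Lang, *Algebra*, GTM 211 (2002), Ch. VIII §1 (transcendence bases), Ch. V §2 Thm. 2.8 (extension of isomorphisms).
* [Robert2000PadicAnalysis] A. M. Robert, *A Course in p-adic Analysis*, GTM 198 (2000), Ch. III §3.5 (`ℂ_p ≅ ℂ` as fields).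
* [Neukirch1999] J. Neukirch, *Algebraic Number Theory* (1999), Ch. II §4 (completions).
-/

set_option autoImplicit false

noncomputable section

open Cardinal IsDedekindDomain NumberField WithZero
open scoped Cardinal

namespace Literature.FieldTheory.AlgClosed

/-! ## §1 `𝔠 ≤ #F_w` and `#F̄_w = 𝔠` -/

/-- **`𝔠 ≤ #F_w`**: the completion of a number field at a finite place is a COMPLETE NON-TRIVIALLY NORMED field (Mathlib's `‖·‖` on
`w.adicCompletion F`; a uniformiser `ϖ` has `‖ϖ‖ < 1`), hence has at least continuum many elements. [cite: Robert2000PadicAnalysis, Ch. III §3.5]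
[cite: Neukirch1999, Ch. II §4] -/
theorem continuum_le_cardinalMk_adicCompletion (F : Type) [Field F] [NumberField F] (w : HeightOneSpectrum (𝓞 F)) :
    𝔠 ≤ #(w.adicCompletion F) := by
  -- a uniformiser: `v ϖ = exp (-1) < 1`, so `ϖ ≠ 0` and `‖ϖ‖ < 1`
  obtain ⟨ϖ, hϖ⟩ := HeightOneSpectrum.valuedAdicCompletion_surjective F w (exp (-1))
  have hv1 : Valued.v ϖ < (1 : ℤᵐ⁰) := by
    rw [hϖ, ← exp_zero, exp_lt_exp]
    norm_num
  have hϖ0 : ϖ ≠ 0 := by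
    rintro rfl
    rw [map_zero] at hϖ
    exact exp_ne_zero hϖ.symm
  have hnorm : ‖ϖ‖ < 1 := by
    have h := (WithZeroMulInt.toNNReal_lt_one_iff (NumberField.HeightOneSpectrum.one_lt_absNorm_nnreal w)).mpr hv1
    rw [NumberField.FinitePlace.norm_def]
    exact_mod_cast h
  letI : NontriviallyNormedField (w.adicCompletion F) := NontriviallyNormedField.ofNormNeOne ⟨ϖ, hϖ0, hnorm.ne⟩
  exact continuum_le_cardinal_of_nontriviallyNormedField (w.adicCompletion F)

/-- **`#F̄_w = 𝔠`**: `𝔠 ≤ #F_w ≤ #F̄_w` (the structure map of the algebraic closure is injective) and `#F̄_w ≤ 𝔠` (★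
`cardinalMk_algebraicClosure_adicCompletion_le_continuum`). [cite: Robert2000PadicAnalysis, Ch. III §3.5] -/
theorem cardinalMk_algebraicClosure_adicCompletion_eq_continuum (F : Type) [Field F] [NumberField F] (w : HeightOneSpectrum (𝓞 F)) :
    #(AlgebraicClosure (w.adicCompletion F)) = 𝔠 :=
  le_antisymm (cardinalMk_algebraicClosure_adicCompletion_le_continuum F w)
    ((continuum_le_cardinalMk_adicCompletion F w).trans
      (mk_le_of_injective (algebraMap (w.adicCompletion F) (AlgebraicClosure (w.adicCompletion F))).injective))

/-! ## §2 `F̄_w ≃ ℂ` as abstract fields -/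

/-- **`F̄_w ≃ ℂ` (Steinitz)**: both are algebraically closed of characteristic `0` and cardinality `𝔠 > ℵ₀` (Mathlib
`IsAlgClosed.ringEquiv_of_equiv_of_charZero`). [cite: Lang2002, Ch. VIII §1 and Ch. V §2 Thm. 2.8] [cite: Robert2000PadicAnalysis, Ch. III §3.5] -/
theorem nonempty_ringEquiv_algebraicClosure_adicCompletion_complex (F : Type) [Field F] [NumberField F] (w : HeightOneSpectrum (𝓞 F)) :
    Nonempty (AlgebraicClosure (w.adicCompletion F) ≃+* ℂ) := by
  haveI := charZero_algebraicClosure_adicCompletion F w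
  refine IsAlgClosed.ringEquiv_of_equiv_of_charZero ?_
    (Cardinal.eq.1 (by rw [cardinalMk_algebraicClosure_adicCompletion_eq_continuum, Cardinal.mk_complex]))
  rw [cardinalMk_algebraicClosure_adicCompletion_eq_continuum]
  exact aleph0_lt_continuum

/-! ## §3 `F̄_w ≃ ℂ` over a prescribed complex embedding `ι₁` of `F` -/

/-- **THE HEAD — `F̄_w ≃ ℂ` OVER `ι₁`**: for every complex embedding `ι₁ : F →+* ℂ` of the number field there is a ring isomorphism
`σ : F̄_w ≃+* ℂ` with `σ ∘ (F → F̄_w) = ι₁` (compose any `F̄_w ≃ ℂ` of §2 with the automorphism of `ℂ` carrying the induced embedding of the countable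
field `F` to `ι₁`, ★ `exists_ringEquiv_apply_eq`).  The E-exports of hodgecm՚s X-LEAF base-change the complex-point readings `RoofE`∕`CoverKerE` along
`Spec σ`. [cite: Lang2002, Ch. VIII §1 and Ch. V §2 Thm. 2.8] [cite: Robert2000PadicAnalysis, Ch. III §3.5] -/
theorem exists_ringEquiv_algebraicClosure_adicCompletion_complex_comp_eq (F : Type) [Field F] [NumberField F]
    (w : HeightOneSpectrum (𝓞 F)) (ι₁ : F →+* ℂ) :
    ∃ σ : AlgebraicClosure (w.adicCompletion F) ≃+* ℂ,
      (σ : AlgebraicClosure (w.adicCompletion F) →+* ℂ).comp (algebraMap F (AlgebraicClosure (w.adicCompletion F))) = ι₁ := by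
  obtain ⟨σ₀⟩ := nonempty_ringEquiv_algebraicClosure_adicCompletion_complex F w
  have hℂ : ℵ₀ < #ℂ := by rw [Cardinal.mk_complex]; exact aleph0_lt_continuum
  have hF : #F ≤ ℵ₀ := (Algebra.IsAlgebraic.cardinalMk_le_max ℚ F).trans (max_le Cardinal.mk_le_aleph0 le_rfl)
  obtain ⟨τ, hτ⟩ := exists_ringEquiv_apply_eq hℂ hF
    ((σ₀ : AlgebraicClosure (w.adicCompletion F) →+* ℂ).comp (algebraMap F (AlgebraicClosure (w.adicCompletion F)))) ι₁
  refine ⟨σ₀.trans τ, ?_⟩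
  ext x
  exact hτ x

/-- The same, pointwise. [cite: Lang2002, Ch. VIII §1 and Ch. V §2 Thm. 2.8] -/
theorem exists_ringEquiv_algebraicClosure_adicCompletion_complex_apply_eq (F : Type) [Field F] [NumberField F]
    (w : HeightOneSpectrum (𝓞 F)) (ι₁ : F →+* ℂ) :
    ∃ σ : AlgebraicClosure (w.adicCompletion F) ≃+* ℂ, ∀ x : F, σ (algebraMap F (AlgebraicClosure (w.adicCompletion F)) x) = ι₁ x := by
  obtain ⟨σ, hσ⟩ := exists_ringEquiv_algebraicClosure_adicCompletion_complex_comp_eq F w ι₁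
  exact ⟨σ, fun x => by rw [← hσ]; rfl⟩

/-- **`F`-ALGEBRA FORM**: with `ℂ` regarded as an `F`-algebra THROUGH `ι₁`, there is an `F`-algebra isomorphism `F̄_w ≃ₐ[F] ℂ` — the shape the
X-LEAF socket `stub_ECtoΩ` quantifies («along an `F`-isomorphism `F̄_w ≃ₐ[F] ℂ`»). [cite: Lang2002, Ch. VIII §1 and Ch. V §2 Thm. 2.8] -/
theorem nonempty_algEquiv_algebraicClosure_adicCompletion_complex (F : Type) [Field F] [NumberField F]
    (w : HeightOneSpectrum (𝓞 F)) (ι₁ : F →+* ℂ) :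
    letI : Algebra F ℂ := ι₁.toAlgebra
    Nonempty (AlgebraicClosure (w.adicCompletion F) ≃ₐ[F] ℂ) := by
  letI : Algebra F ℂ := ι₁.toAlgebra
  obtain ⟨σ, hσ⟩ := exists_ringEquiv_algebraicClosure_adicCompletion_complex_apply_eq F w ι₁
  exact ⟨AlgEquiv.ofRingEquiv (f := σ) fun x => hσ x⟩

/-! ## §4 (ED. 2, add-only) `F̄_w ≃ ℂ` RELATIVE TO A SHEET: carrying a prescribed embedding `e : L → F̄_w` of a countable field to a prescribed `τ : L → ℂ`

(hodgecm L4 (S5) seam, LA7-p01 (g3) LEG-D of the `stub_SHEET` closer: the `F̄_w`-sheet `e′ : Fᵢ → F̄_w` must land on the chart sheet `τE : Fᵢ → ℂ`, i.e.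
`σ ∘ e′ = τE`, so that the `F̄_w`-points `ℓ_{e′} y` pushed along `Spec σ` are `ℂ`-points of `X ⊗_{Fᵢ, τE} ℂ`.)  Same argument as §3 with the countable field
`L` (a number field `Fᵢ`) in place of `F`: compose any `F̄_w ≃ ℂ` of §2 with the automorphism of `ℂ` carrying `σ₀ ∘ e` to `τ` (★ `exists_ringEquiv_apply_eq`). -/

/-- **(ED. 2) `F̄_w ≃ ℂ` CARRYING A PRESCRIBED EMBEDDING OF A COUNTABLE FIELD TO A PRESCRIBED COMPLEX EMBEDDING**: for a field `L` with `#L ≤ ℵ₀`,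
any `e : L →+* F̄_w` and `τ : L →+* ℂ`, there is a ring isomorphism `σ : F̄_w ≃+* ℂ` with `σ ∘ e = τ` (Steinitz: two embeddings of a countable field into
the algebraically closed field `ℂ` of uncountable transcendence degree are conjugate under `Aut ℂ`). [cite: Lang2002, Ch. VIII §1 and Ch. V §2 Thm. 2.8]
[cite: Robert2000PadicAnalysis, Ch. III §3.5] -/
theorem exists_ringEquiv_algebraicClosure_adicCompletion_complex_comp_eq_of_hom (F : Type) [Field F] [NumberField F]
    (w : HeightOneSpectrum (𝓞 F)) {L : Type} [Field L] (hL : #L ≤ ℵ₀) (e : L →+* AlgebraicClosure (w.adicCompletion F)) (τ : L →+* ℂ) :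
    ∃ σ : AlgebraicClosure (w.adicCompletion F) ≃+* ℂ, (σ : AlgebraicClosure (w.adicCompletion F) →+* ℂ).comp e = τ := by
  obtain ⟨σ₀⟩ := nonempty_ringEquiv_algebraicClosure_adicCompletion_complex F w
  have hℂ : ℵ₀ < #ℂ := by rw [Cardinal.mk_complex]; exact aleph0_lt_continuum
  obtain ⟨ρ, hρ⟩ := exists_ringEquiv_apply_eq hℂ hL ((σ₀ : AlgebraicClosure (w.adicCompletion F) →+* ℂ).comp e) τ
  refine ⟨σ₀.trans ρ, ?_⟩
  ext x
  exact hρ x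

/-- **(ED. 2) The same for a number field `Fᵢ`, pointwise**: `∃ σ : F̄_w ≃+* ℂ, ∀ x, σ (e x) = τ x` (a number field is countable).
[cite: Lang2002, Ch. VIII §1 and Ch. V §2 Thm. 2.8] -/
theorem exists_ringEquiv_algebraicClosure_adicCompletion_complex_apply_eq_of_hom (F : Type) [Field F] [NumberField F]
    (w : HeightOneSpectrum (𝓞 F)) {Fi : Type} [Field Fi] [NumberField Fi] (e : Fi →+* AlgebraicClosure (w.adicCompletion F)) (τ : Fi →+* ℂ) :
    ∃ σ : AlgebraicClosure (w.adicCompletion F) ≃+* ℂ, ∀ x : Fi, σ (e x) = τ x := by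
  have hFi : #Fi ≤ ℵ₀ := (Algebra.IsAlgebraic.cardinalMk_le_max ℚ Fi).trans (max_le Cardinal.mk_le_aleph0 le_rfl)
  obtain ⟨σ, hσ⟩ := exists_ringEquiv_algebraicClosure_adicCompletion_complex_comp_eq_of_hom F w hFi e τ
  exact ⟨σ, fun x => by rw [← hσ]; rfl⟩

/-- **(ED. 2) `F`-ALGEBRA FORM RELATIVE TO A SHEET**: `Fᵢ ⊇ F` a number field, `e′ : Fᵢ →ₐ[F] F̄_w` a sheet and `τE : Fᵢ →+* ℂ` a complex embedding over
`ι₁` (`τE ∘ (F → Fᵢ) = ι₁`).  With `ℂ` an `F`-algebra THROUGH `ι₁` there is an `F`-algebra isomorphism `σ : F̄_w ≃ₐ[F] ℂ` with `σ (e′ x) = τE x` for every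
`x : Fᵢ` — it is over `F` automatically, since `σ ∘ (F → F̄_w) = σ ∘ e′ ∘ (F → Fᵢ) = τE ∘ (F → Fᵢ) = ι₁`.  (hodgecm L4: the sheet-relative form of §3 that the
`stub_SHEET` closer՚s LEG-D uses to read the pair `(ℓ_{e′} y, ℓ_{e′∘γ} y)` inside `X ⊗_{Fᵢ,τE} ℂ`.) [cite: Lang2002, Ch. VIII §1 and Ch. V §2 Thm. 2.8]
[cite: Robert2000PadicAnalysis, Ch. III §3.5] -/
theorem exists_algEquiv_algebraicClosure_adicCompletion_complex_apply_eq (F : Type) [Field F] [NumberField F]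
    (w : HeightOneSpectrum (𝓞 F)) (ι₁ : F →+* ℂ) {Fi : Type} [Field Fi] [NumberField Fi] [Algebra F Fi]
    (e' : Fi →ₐ[F] AlgebraicClosure (w.adicCompletion F)) (τE : Fi →+* ℂ) (hτE : τE.comp (algebraMap F Fi) = ι₁) :
    letI : Algebra F ℂ := ι₁.toAlgebra
    ∃ σ : AlgebraicClosure (w.adicCompletion F) ≃ₐ[F] ℂ, ∀ x : Fi, σ (e' x) = τE x := by
  letI : Algebra F ℂ := ι₁.toAlgebra
  obtain ⟨σ, hσ⟩ := exists_ringEquiv_algebraicClosure_adicCompletion_complex_apply_eq_of_hom F w e'.toRingHom τE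
  have hσ' : ∀ x : Fi, σ (e' x) = τE x := fun x => hσ x
  refine ⟨AlgEquiv.ofRingEquiv (f := σ) fun a => ?_, hσ'⟩
  -- over `F`: `σ (F → F̄_w) a = σ (e′ ((F → Fᵢ) a)) = τE ((F → Fᵢ) a) = ι₁ a`
  rw [← e'.commutes a, hσ', ← RingHom.comp_apply, hτE]
  rfl

/-- **(ED. 2) The same, as a composition of ring homomorphisms**: `σ ∘ e′ = τE` for the `F`-algebra isomorphism `σ` (the form `(σ.toAlgHom.comp e′).toRingHom = τE`
in which the sheet `σ ∘ e′ : Fᵢ →ₐ[F] ℂ` is compared with the chart sheet). [cite: Lang2002, Ch. VIII §1 and Ch. V §2 Thm. 2.8] -/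
theorem exists_algEquiv_algebraicClosure_adicCompletion_complex_comp_eq (F : Type) [Field F] [NumberField F]
    (w : HeightOneSpectrum (𝓞 F)) (ι₁ : F →+* ℂ) {Fi : Type} [Field Fi] [NumberField Fi] [Algebra F Fi]
    (e' : Fi →ₐ[F] AlgebraicClosure (w.adicCompletion F)) (τE : Fi →+* ℂ) (hτE : τE.comp (algebraMap F Fi) = ι₁) :
    letI : Algebra F ℂ := ι₁.toAlgebra
    ∃ σ : AlgebraicClosure (w.adicCompletion F) ≃ₐ[F] ℂ, (σ.toAlgHom.comp e').toRingHom = τE := by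
  letI : Algebra F ℂ := ι₁.toAlgebra
  obtain ⟨σ, hσ⟩ := exists_algEquiv_algebraicClosure_adicCompletion_complex_apply_eq F w ι₁ e' τE hτE
  exact ⟨σ, RingHom.ext fun x => hσ x⟩

end Literature.FieldTheory.AlgClosed

end
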